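import Summits.CriticalPhenomena.CardyFormulaZ2.Theses.CardyBoundaryCoulombGas

/-!
# Bethe kernel toolkit (line `two-cluster-rate-is-stationary-gap`, crux `StripClusterRates`)

Elementary facts (Mathlib only) about the three explicit functions of the registered Bethe stubs
`stub_betheGroundExists`, `stub_escapeIsBethe`, `stub_relaxIsBethe`, `stub_betheKacOne`, `stub_betheKacTwo`
(open staggered Temperley–Lieb(1) chain at `γ = π/3`, Yung–Batchelor form of the ground-state Bethe equations),
stated over the INLINED expressions exactly as they occur there:
* momentum phase `F(w) = arctan((2+√3)·tanh w) + arctan(tanh w)`: strictly increasing, continuous, odd,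
  `|F| < 2π/3 = arctan(2+√3) + arctan 1`, `F → 2π/3` at `+∞`, `F` maps `[0,∞)` onto `[0, 2π/3)`;
* scattering phase `G(x) = arctan(tanh x/√3)`: strictly increasing, continuous, odd, `|G| < π/6`, `G → π/6`;
* one-root factor `f(w) = (4 sinh² w + 2)/(4 sinh² w + 2 - √3)`: `1 < f ≤ f 0 = 4 + 2√3`, even, antitone on
  `[0, ∞)`, continuous, `f → 1`; Bethe eigenvalue `Λ = (∏ f(w_j))/2^(2n+1) > 0`,
  `-log Λ = (2n+1) log 2 - ∑ log f(w_j)`, window `(2n+1) log 2 - M log(4+2√3) ≤ -log Λ ≤ (2n+1) log 2`.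
The umbrella statement `bk_betheKernel_toolkit` is the registered helper signature.
-/

noncomputable section

namespace Summit.CriticalPhenomena.CardyFormulaZ2.Cruxes.StripClusterRates.TwoClusterRateIsStationaryGap

open Filter Topology
open scoped BigOperators

/-! ### The constant `arctan(2+√3) + arctan 1 = 2π/3` -/

/-- The exact value of the momentum phase at `+∞`: `arctan(2+√3) + arctan 1 = 2π/3`
(`arctan(2+√3) = 5π/12`, `arctan 1 = π/4`). [folklore] -/
theorem bk_arctan_two_add_sqrt_three_add_arctan_one :
    Real.arctan (2 + Real.sqrt 3) + Real.arctan 1 = 2 * Real.pi / 3 := by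
  have hs : Real.sqrt 3 ^ 2 = 3 := Real.sq_sqrt (by norm_num)
  have h0 : (0 : ℝ) ≤ Real.sqrt 3 := Real.sqrt_nonneg 3
  have hx : (0 : ℝ) < 2 + Real.sqrt 3 := by linarith
  have h1 : (1 : ℝ) < (2 + Real.sqrt 3) * 1 := by linarith
  rw [Real.arctan_add_eq_add_pi h1 hx]
  have hne : (1 : ℝ) - (2 + Real.sqrt 3) * 1 ≠ 0 :=
    (by linarith : (1 : ℝ) - (2 + Real.sqrt 3) * 1 < 0).ne
  have hq : (2 + Real.sqrt 3 + 1) / (1 - (2 + Real.sqrt 3) * 1) = -Real.sqrt 3 := by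
    rw [div_eq_iff hne]
    linear_combination (-1 : ℝ) * hs
  rw [hq, Real.arctan_neg, Real.arctan_sqrt_three]
  ring

/-! ### `tanh`: strict monotonicity and the limit at `+∞` (not in Mathlib) -/

/-- `tanh` is strictly increasing. [folklore] -/
theorem bk_tanh_strictMono : StrictMono Real.tanh := by
  intro x y hxy
  have key : ∀ t : ℝ, Real.tanh t = 1 - 2 / (Real.exp (2 * t) + 1) := fun t => by
    rw [Real.tanh_eq, Real.exp_neg, show Real.exp (2 * t) = Real.exp t * Real.exp t by
      rw [two_mul, Real.exp_add]]
    have ht : 0 < Real.exp t := Real.exp_pos t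
    field_simp
    ring
  rw [key x, key y]
  have hx : 0 < Real.exp (2 * x) + 1 := by positivity
  have hxy' : Real.exp (2 * x) + 1 < Real.exp (2 * y) + 1 := by
    have := Real.exp_lt_exp.2 (by linarith : 2 * x < 2 * y)
    linarith
  have : 2 / (Real.exp (2 * y) + 1) < 2 / (Real.exp (2 * x) + 1) :=
    div_lt_div_of_pos_left (by norm_num) hx hxy'
  linarith

/-- `tanh x → 1` as `x → +∞`. [folklore] -/
theorem bk_tanh_tendsto_atTop : Tendsto Real.tanh atTop (𝓝 1) := by
  have key : ∀ t : ℝ, Real.tanh t = 1 - 2 / (Real.exp (2 * t) + 1) := fun t => by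
    rw [Real.tanh_eq, Real.exp_neg, show Real.exp (2 * t) = Real.exp t * Real.exp t by
      rw [two_mul, Real.exp_add]]
    have ht : 0 < Real.exp t := Real.exp_pos t
    field_simp
    ring
  have h2 : Tendsto (fun x : ℝ => Real.exp (2 * x) + 1) atTop atTop :=
    tendsto_atTop_add_const_right _ _
      (Real.tendsto_exp_atTop.comp (tendsto_id.const_mul_atTop (by norm_num : (0 : ℝ) < 2)))
  have h : Tendsto (fun x : ℝ => 1 - 2 / (Real.exp (2 * x) + 1)) atTop (𝓝 (1 - 0)) :=
    tendsto_const_nhds.sub (tendsto_const_nhds.div_atTop h2)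
  rw [sub_zero] at h
  exact h.congr fun x => (key x).symm

/-! ### The momentum phase `F(w) = arctan((2+√3) tanh w) + arctan(tanh w)` -/

/-- `F` is strictly increasing. [folklore] -/
theorem bk_F_strictMono :
    StrictMono (fun w : ℝ ↦ Real.arctan ((2 + Real.sqrt 3) * Real.tanh w) + Real.arctan (Real.tanh w)) := by
  intro x y hxy
  have hc : (0 : ℝ) < 2 + Real.sqrt 3 := by linarith [Real.sqrt_nonneg 3]
  have h1 := Real.arctan_strictMono (mul_lt_mul_of_pos_left (bk_tanh_strictMono hxy) hc)
  have h2 := Real.arctan_strictMono (bk_tanh_strictMono hxy)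
  exact add_lt_add h1 h2

/-- `F` is continuous. [folklore] -/
theorem bk_F_continuous :
    Continuous (fun w : ℝ ↦ Real.arctan ((2 + Real.sqrt 3) * Real.tanh w) + Real.arctan (Real.tanh w)) := by
  have htanh : Continuous Real.tanh := by
    rw [show Real.tanh = fun x => Real.sinh x / Real.cosh x from funext Real.tanh_eq_sinh_div_cosh]
    exact Real.continuous_sinh.div Real.continuous_cosh fun x => (Real.cosh_pos x).ne'
  exact (Real.continuous_arctan.comp' (continuous_const.mul htanh)).add (Real.continuous_arctan.comp' htanh)

/-- `F` is odd. [folklore] -/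
theorem bk_F_neg (w : ℝ) :
    Real.arctan ((2 + Real.sqrt 3) * Real.tanh (-w)) + Real.arctan (Real.tanh (-w)) =
      -(Real.arctan ((2 + Real.sqrt 3) * Real.tanh w) + Real.arctan (Real.tanh w)) := by
  simp only [Real.tanh_neg, mul_neg, Real.arctan_neg]
  ring

/-- `F 0 = 0`. [folklore] -/
theorem bk_F_zero : Real.arctan ((2 + Real.sqrt 3) * Real.tanh 0) + Real.arctan (Real.tanh 0) = 0 := by
  simp [Real.tanh_zero, Real.arctan_zero]

/-- `0 < F w` for `0 < w`. [folklore] -/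
theorem bk_F_pos {w : ℝ} (hw : 0 < w) :
    0 < Real.arctan ((2 + Real.sqrt 3) * Real.tanh w) + Real.arctan (Real.tanh w) := by
  simpa only [Real.tanh_zero, mul_zero, Real.arctan_zero, add_zero] using bk_F_strictMono hw

/-- The supremum bound `F w < 2π/3`. [folklore] -/
theorem bk_F_lt (w : ℝ) :
    Real.arctan ((2 + Real.sqrt 3) * Real.tanh w) + Real.arctan (Real.tanh w) < 2 * Real.pi / 3 := by
  rw [← bk_arctan_two_add_sqrt_three_add_arctan_one]
  have hc : (0 : ℝ) < 2 + Real.sqrt 3 := by linarith [Real.sqrt_nonneg 3]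
  have h1 : (2 + Real.sqrt 3) * Real.tanh w < 2 + Real.sqrt 3 := by
    have := mul_lt_mul_of_pos_left (Real.tanh_lt_one w) hc
    simpa using this
  exact add_lt_add (Real.arctan_strictMono h1) (Real.arctan_strictMono (Real.tanh_lt_one w))

/-- The infimum bound `-(2π/3) < F w`. [folklore] -/
theorem bk_F_gt (w : ℝ) :
    -(2 * Real.pi / 3) < Real.arctan ((2 + Real.sqrt 3) * Real.tanh w) + Real.arctan (Real.tanh w) := by
  have h := bk_F_lt (-w)
  rw [bk_F_neg] at h; linarith

/-- `|F w| < 2π/3`. [folklore] -/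
theorem bk_F_abs_lt (w : ℝ) :
    |Real.arctan ((2 + Real.sqrt 3) * Real.tanh w) + Real.arctan (Real.tanh w)| < 2 * Real.pi / 3 :=
  abs_lt.2 ⟨bk_F_gt w, bk_F_lt w⟩

/-- `F w → 2π/3` as `w → +∞`. [folklore] -/
theorem bk_F_tendsto_atTop :
    Tendsto (fun w : ℝ ↦ Real.arctan ((2 + Real.sqrt 3) * Real.tanh w) + Real.arctan (Real.tanh w)) atTop
      (𝓝 (2 * Real.pi / 3)) := by
  rw [← bk_arctan_two_add_sqrt_three_add_arctan_one]
  refine Tendsto.add ?_ ?_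
  · have h := bk_tanh_tendsto_atTop.const_mul (2 + Real.sqrt 3)
    rw [mul_one] at h
    exact (Real.continuous_arctan.tendsto _).comp h
  · exact (Real.continuous_arctan.tendsto _).comp bk_tanh_tendsto_atTop

/-- `F` takes every value of `[0, 2π/3)` on `[0, ∞)` (intermediate values; the inverse needed for the
fixed-point form `w_j = F⁻¹(…)` of the Bethe equations). [folklore] -/
theorem bk_F_surjOn {y : ℝ} (hy0 : 0 ≤ y) (hy : y < 2 * Real.pi / 3) :
    ∃ w : ℝ, 0 ≤ w ∧ Real.arctan ((2 + Real.sqrt 3) * Real.tanh w) + Real.arctan (Real.tanh w) = y := by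
  -- pick `b ≥ 0` with `y < F b` (limit at `+∞`), then intermediate value theorem on `[0, b]`
  have hev : ∀ᶠ w in atTop, y < Real.arctan ((2 + Real.sqrt 3) * Real.tanh w) + Real.arctan (Real.tanh w) :=
    bk_F_tendsto_atTop.eventually (lt_mem_nhds hy)
  obtain ⟨b, hb, hb0⟩ := (hev.and (eventually_ge_atTop 0)).exists
  have hcont := bk_F_continuous.continuousOn (s := Set.Icc 0 b)
  have hmem : y ∈ Set.Icc (Real.arctan ((2 + Real.sqrt 3) * Real.tanh 0) + Real.arctan (Real.tanh 0))
      (Real.arctan ((2 + Real.sqrt 3) * Real.tanh b) + Real.arctan (Real.tanh b)) := by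
    rw [bk_F_zero]; exact ⟨hy0, hb.le⟩
  obtain ⟨w, hw, hwy⟩ := intermediate_value_Icc hb0 hcont hmem
  exact ⟨w, hw.1, hwy⟩

/-! ### The scattering phase `G(x) = arctan(tanh x/√3)` -/

/-- `G` is strictly increasing. [folklore] -/
theorem bk_G_strictMono : StrictMono (fun x : ℝ ↦ Real.arctan (Real.tanh x / Real.sqrt 3)) := fun _ _ hxy =>
  Real.arctan_strictMono
    (div_lt_div_of_pos_right (bk_tanh_strictMono hxy) (Real.sqrt_pos.2 (by norm_num : (0 : ℝ) < 3)))

/-- `G` is continuous. [folklore] -/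
theorem bk_G_continuous : Continuous (fun x : ℝ ↦ Real.arctan (Real.tanh x / Real.sqrt 3)) := by
  have htanh : Continuous Real.tanh := by
    rw [show Real.tanh = fun x => Real.sinh x / Real.cosh x from funext Real.tanh_eq_sinh_div_cosh]
    exact Real.continuous_sinh.div Real.continuous_cosh fun x => (Real.cosh_pos x).ne'
  exact Real.continuous_arctan.comp' (htanh.div_const _)

/-- `G` is odd. [folklore] -/
theorem bk_G_neg (x : ℝ) :
    Real.arctan (Real.tanh (-x) / Real.sqrt 3) = -Real.arctan (Real.tanh x / Real.sqrt 3) := by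
  simp only [Real.tanh_neg, neg_div, Real.arctan_neg]

/-- `G 0 = 0`. [folklore] -/
theorem bk_G_zero : Real.arctan (Real.tanh 0 / Real.sqrt 3) = 0 := by
  simp [Real.tanh_zero, Real.arctan_zero]

/-- `0 < G x` for `0 < x`. [folklore] -/
theorem bk_G_pos {x : ℝ} (hx : 0 < x) : 0 < Real.arctan (Real.tanh x / Real.sqrt 3) := by
  simpa only [Real.tanh_zero, zero_div, Real.arctan_zero] using bk_G_strictMono hx

/-- The supremum bound `G x < π/6`. [folklore] -/
theorem bk_G_lt (x : ℝ) : Real.arctan (Real.tanh x / Real.sqrt 3) < Real.pi / 6 := by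
  rw [← Real.arctan_inv_sqrt_three, ← one_div]
  exact Real.arctan_strictMono
    (div_lt_div_of_pos_right (Real.tanh_lt_one x) (Real.sqrt_pos.2 (by norm_num : (0 : ℝ) < 3)))

/-- The infimum bound `-(π/6) < G x`. [folklore] -/
theorem bk_G_gt (x : ℝ) : -(Real.pi / 6) < Real.arctan (Real.tanh x / Real.sqrt 3) := by
  have h := bk_G_lt (-x)
  rw [bk_G_neg] at h; linarith

/-- `|G x| < π/6`. [folklore] -/
theorem bk_G_abs_lt (x : ℝ) : |Real.arctan (Real.tanh x / Real.sqrt 3)| < Real.pi / 6 :=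
  abs_lt.2 ⟨bk_G_gt x, bk_G_lt x⟩

/-- `G x → π/6` as `x → +∞`. [folklore] -/
theorem bk_G_tendsto_atTop :
    Tendsto (fun x : ℝ ↦ Real.arctan (Real.tanh x / Real.sqrt 3)) atTop (𝓝 (Real.pi / 6)) := by
  rw [← Real.arctan_inv_sqrt_three, ← one_div]
  exact (Real.continuous_arctan.tendsto _).comp (bk_tanh_tendsto_atTop.div_const _)

/-! ### The one-root factor `f(w) = (4 sinh² w + 2)/(4 sinh² w + 2 - √3)` -/

/-- The denominator of `f` is positive. [folklore] -/
theorem bk_f_den_pos (w : ℝ) : 0 < 4 * Real.sinh w ^ 2 + 2 - Real.sqrt 3 := by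
  nlinarith [sq_nonneg (Real.sinh w), Real.sq_sqrt (show (0 : ℝ) ≤ 3 by norm_num), Real.sqrt_nonneg 3]

/-- The numerator of `f` is positive. [folklore] -/
theorem bk_f_num_pos (w : ℝ) : 0 < 4 * Real.sinh w ^ 2 + 2 := by positivity

/-- `0 < f w`. [folklore] -/
theorem bk_f_pos (w : ℝ) : 0 < (4 * Real.sinh w ^ 2 + 2) / (4 * Real.sinh w ^ 2 + 2 - Real.sqrt 3) :=
  div_pos (bk_f_num_pos w) (bk_f_den_pos w)

/-- `1 < f w` (so every Bethe root LOWERS the rate `-log Λ`). [folklore] -/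
theorem bk_one_lt_f (w : ℝ) : 1 < (4 * Real.sinh w ^ 2 + 2) / (4 * Real.sinh w ^ 2 + 2 - Real.sqrt 3) := by
  rw [one_lt_div (bk_f_den_pos w)]
  linarith [(Real.sqrt_pos.2 (by norm_num : (0 : ℝ) < 3))]

/-- `f = 1 + √3/(denominator)`. [folklore] -/
theorem bk_f_eq_one_add (w : ℝ) :
    (4 * Real.sinh w ^ 2 + 2) / (4 * Real.sinh w ^ 2 + 2 - Real.sqrt 3) =
      1 + Real.sqrt 3 / (4 * Real.sinh w ^ 2 + 2 - Real.sqrt 3) := by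
  have h := (bk_f_den_pos w).ne'
  field_simp
  ring

/-- `f 0 = 2/(2-√3) = 4 + 2√3`. [folklore] -/
theorem bk_f_zero :
    (4 * Real.sinh 0 ^ 2 + 2) / (4 * Real.sinh 0 ^ 2 + 2 - Real.sqrt 3) = 4 + 2 * Real.sqrt 3 := by
  have hs : Real.sqrt 3 ^ 2 = 3 := Real.sq_sqrt (by norm_num)
  rw [div_eq_iff (bk_f_den_pos 0).ne', Real.sinh_zero]
  linear_combination (2 : ℝ) * hs

/-- The maximum bound `f w ≤ 4 + 2√3 = f 0`. [folklore] -/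
theorem bk_f_le (w : ℝ) :
    (4 * Real.sinh w ^ 2 + 2) / (4 * Real.sinh w ^ 2 + 2 - Real.sqrt 3) ≤ 4 + 2 * Real.sqrt 3 := by
  have hs : Real.sqrt 3 ^ 2 = 3 := Real.sq_sqrt (by norm_num)
  have h0 : (0 : ℝ) ≤ Real.sqrt 3 := Real.sqrt_nonneg 3
  rw [div_le_iff₀ (bk_f_den_pos w)]
  nlinarith [sq_nonneg (Real.sinh w), mul_nonneg h0 (sq_nonneg (Real.sinh w))]

/-- `f` is even. [folklore] -/
theorem bk_f_neg (w : ℝ) :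
    (4 * Real.sinh (-w) ^ 2 + 2) / (4 * Real.sinh (-w) ^ 2 + 2 - Real.sqrt 3) =
      (4 * Real.sinh w ^ 2 + 2) / (4 * Real.sinh w ^ 2 + 2 - Real.sqrt 3) := by
  simp only [Real.sinh_neg, neg_sq]

/-- `f` is strictly decreasing on `[0, ∞)`: `0 ≤ a < b → f b < f a`. [folklore] -/
theorem bk_f_strictAntiOn :
    StrictAntiOn (fun w : ℝ ↦ (4 * Real.sinh w ^ 2 + 2) / (4 * Real.sinh w ^ 2 + 2 - Real.sqrt 3))
      (Set.Ici 0) := by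
  intro a ha b _ hab
  have ha' : 0 ≤ Real.sinh a := Real.sinh_nonneg_iff.2 ha
  have hsinh : Real.sinh a < Real.sinh b := Real.sinh_lt_sinh.2 hab
  have hsq : Real.sinh a ^ 2 < Real.sinh b ^ 2 := by nlinarith
  show (4 * Real.sinh b ^ 2 + 2) / (4 * Real.sinh b ^ 2 + 2 - Real.sqrt 3) <
    (4 * Real.sinh a ^ 2 + 2) / (4 * Real.sinh a ^ 2 + 2 - Real.sqrt 3)
  rw [bk_f_eq_one_add, bk_f_eq_one_add]
  have h := div_lt_div_of_pos_left (Real.sqrt_pos.2 (by norm_num : (0 : ℝ) < 3)) (bk_f_den_pos a)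
    (by linarith : 4 * Real.sinh a ^ 2 + 2 - Real.sqrt 3 < 4 * Real.sinh b ^ 2 + 2 - Real.sqrt 3)
  linarith

/-- `f` is antitone on `[0, ∞)`. [folklore] -/
theorem bk_f_antitoneOn :
    AntitoneOn (fun w : ℝ ↦ (4 * Real.sinh w ^ 2 + 2) / (4 * Real.sinh w ^ 2 + 2 - Real.sqrt 3))
      (Set.Ici 0) :=
  bk_f_strictAntiOn.antitoneOn

/-- `f` is continuous. [folklore] -/
theorem bk_f_continuous :
    Continuous (fun w : ℝ ↦ (4 * Real.sinh w ^ 2 + 2) / (4 * Real.sinh w ^ 2 + 2 - Real.sqrt 3)) :=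
  ((continuous_const.mul (Real.continuous_sinh.pow 2)).add continuous_const).div
    (((continuous_const.mul (Real.continuous_sinh.pow 2)).add continuous_const).sub continuous_const)
    fun w => (bk_f_den_pos w).ne'

/-- The denominator of `f` tends to `+∞`. [folklore] -/
theorem bk_f_den_tendsto_atTop :
    Tendsto (fun w : ℝ ↦ 4 * Real.sinh w ^ 2 + 2 - Real.sqrt 3) atTop atTop := by
  have hlow : Tendsto (fun w : ℝ ↦ 4 * w ^ 2 + (2 - Real.sqrt 3)) atTop atTop :=
    tendsto_atTop_add_const_right _ _
      ((tendsto_pow_atTop two_ne_zero).const_mul_atTop (by norm_num : (0 : ℝ) < 4))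
  refine tendsto_atTop_mono' atTop ?_ hlow
  filter_upwards [eventually_ge_atTop (0 : ℝ)] with w hw
  have h1 : w ≤ Real.sinh w := Real.self_le_sinh_iff.2 hw
  have h2 : w ^ 2 ≤ Real.sinh w ^ 2 := by nlinarith
  linarith

/-- `f w → 1` as `w → +∞`. [folklore] -/
theorem bk_f_tendsto_atTop :
    Tendsto (fun w : ℝ ↦ (4 * Real.sinh w ^ 2 + 2) / (4 * Real.sinh w ^ 2 + 2 - Real.sqrt 3)) atTop (𝓝 1) := by
  have h : Tendsto (fun w : ℝ ↦ 1 + Real.sqrt 3 / (4 * Real.sinh w ^ 2 + 2 - Real.sqrt 3)) atTop (𝓝 (1 + 0)) :=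
    tendsto_const_nhds.add (tendsto_const_nhds.div_atTop bk_f_den_tendsto_atTop)
  rw [add_zero] at h
  exact h.congr fun w => (bk_f_eq_one_add w).symm

/-! ### The Bethe product `Λ = (∏ j, f (w j)) / 2^(2n+1)` -/

/-- The Bethe product is positive. [folklore] -/
theorem bk_betheProd_pos {M : ℕ} (w : Fin M → ℝ) :
    0 < ∏ j, (4 * Real.sinh (w j) ^ 2 + 2) / (4 * Real.sinh (w j) ^ 2 + 2 - Real.sqrt 3) :=
  Finset.prod_pos fun j _ => bk_f_pos (w j)

/-- `1 ≤ ∏ f(w_j)`. [folklore] -/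
theorem bk_one_le_betheProd {M : ℕ} (w : Fin M → ℝ) :
    1 ≤ ∏ j, (4 * Real.sinh (w j) ^ 2 + 2) / (4 * Real.sinh (w j) ^ 2 + 2 - Real.sqrt 3) := by
  calc (1 : ℝ) = ∏ _j : Fin M, (1 : ℝ) := by simp
    _ ≤ ∏ j, (4 * Real.sinh (w j) ^ 2 + 2) / (4 * Real.sinh (w j) ^ 2 + 2 - Real.sqrt 3) :=
        Finset.prod_le_prod (fun _ _ => zero_le_one) fun j _ => (bk_one_lt_f (w j)).le

/-- `∏ f(w_j) ≤ (4 + 2√3)^M`. [folklore] -/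
theorem bk_betheProd_le {M : ℕ} (w : Fin M → ℝ) :
    ∏ j, (4 * Real.sinh (w j) ^ 2 + 2) / (4 * Real.sinh (w j) ^ 2 + 2 - Real.sqrt 3) ≤
      (4 + 2 * Real.sqrt 3) ^ M := by
  calc ∏ j, (4 * Real.sinh (w j) ^ 2 + 2) / (4 * Real.sinh (w j) ^ 2 + 2 - Real.sqrt 3)
        ≤ ∏ _j : Fin M, (4 + 2 * Real.sqrt 3) :=
        Finset.prod_le_prod (fun j _ => (bk_f_pos (w j)).le) fun j _ => bk_f_le (w j)
    _ = (4 + 2 * Real.sqrt 3) ^ M := by simp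

/-- The Bethe eigenvalue `Λ = (∏ f)/2^(2n+1)` is positive (so `Real.log Λ` is the genuine logarithm). [folklore] -/
theorem bk_betheLambda_pos {M : ℕ} (n : ℕ) (w : Fin M → ℝ) :
    0 < (∏ j, (4 * Real.sinh (w j) ^ 2 + 2) / (4 * Real.sinh (w j) ^ 2 + 2 - Real.sqrt 3)) / 2 ^ (2 * n + 1) :=
  div_pos (bk_betheProd_pos w) (pow_pos two_pos _)

/-- The rate in additive form: `-log Λ = (2n+1) log 2 - ∑ log f(w_j)`. [folklore] -/
theorem bk_neg_log_betheLambda {M : ℕ} (n : ℕ) (w : Fin M → ℝ) :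
    -Real.log ((∏ j, (4 * Real.sinh (w j) ^ 2 + 2) / (4 * Real.sinh (w j) ^ 2 + 2 - Real.sqrt 3)) /
        2 ^ (2 * n + 1)) =
      (2 * n + 1 : ℕ) * Real.log 2 -
        ∑ j, Real.log ((4 * Real.sinh (w j) ^ 2 + 2) / (4 * Real.sinh (w j) ^ 2 + 2 - Real.sqrt 3)) := by
  rw [Real.log_div (bk_betheProd_pos w).ne' (pow_pos two_pos _).ne', Real.log_prod,
    Real.log_pow]
  · ring
  · intro j _
    exact (bk_f_pos (w j)).ne'

/-- Each `log f(w_j)` is positive. [folklore] -/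
theorem bk_log_f_pos (w : ℝ) :
    0 < Real.log ((4 * Real.sinh w ^ 2 + 2) / (4 * Real.sinh w ^ 2 + 2 - Real.sqrt 3)) :=
  Real.log_pos (bk_one_lt_f w)

/-- Rate window, upper: `-log Λ ≤ (2n+1) log 2`. [folklore] -/
theorem bk_neg_log_betheLambda_le {M : ℕ} (n : ℕ) (w : Fin M → ℝ) :
    -Real.log ((∏ j, (4 * Real.sinh (w j) ^ 2 + 2) / (4 * Real.sinh (w j) ^ 2 + 2 - Real.sqrt 3)) /
        2 ^ (2 * n + 1)) ≤ (2 * n + 1 : ℕ) * Real.log 2 := by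
  rw [bk_neg_log_betheLambda]
  have : 0 ≤ ∑ j, Real.log ((4 * Real.sinh (w j) ^ 2 + 2) / (4 * Real.sinh (w j) ^ 2 + 2 - Real.sqrt 3)) :=
    Finset.sum_nonneg fun j _ => (bk_log_f_pos (w j)).le
  linarith

/-- Rate window, lower: `(2n+1) log 2 - M log(4+2√3) ≤ -log Λ`. [folklore] -/
theorem bk_le_neg_log_betheLambda {M : ℕ} (n : ℕ) (w : Fin M → ℝ) :
    (2 * n + 1 : ℕ) * Real.log 2 - M * Real.log (4 + 2 * Real.sqrt 3) ≤
      -Real.log ((∏ j, (4 * Real.sinh (w j) ^ 2 + 2) / (4 * Real.sinh (w j) ^ 2 + 2 - Real.sqrt 3)) /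
        2 ^ (2 * n + 1)) := by
  rw [bk_neg_log_betheLambda]
  have h : ∑ j, Real.log ((4 * Real.sinh (w j) ^ 2 + 2) / (4 * Real.sinh (w j) ^ 2 + 2 - Real.sqrt 3)) ≤
      ∑ _j : Fin M, Real.log (4 + 2 * Real.sqrt 3) :=
    Finset.sum_le_sum fun j _ => Real.log_le_log (bk_f_pos (w j)) (bk_f_le (w j))
  have h' : ∑ _j : Fin M, Real.log (4 + 2 * Real.sqrt 3) = M * Real.log (4 + 2 * Real.sqrt 3) := by simp
  linarith

/-! ### Umbrella statement (the registered helper signature) -/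

/-- **Bethe kernel toolkit** (registered helper of `stmt-CriticalPhenomena-13878`, line
`two-cluster-rate-is-stationary-gap`): monotonicity, range and limits of the momentum phase `F`, the scattering
phase `G` and the one-root factor `f` of the open staggered TL(1) chain's Bethe equations. [folklore] -/
theorem bk_betheKernel_toolkit : StrictMono (fun w : ℝ ↦ Real.arctan ((2 + Real.sqrt 3) * Real.tanh w) + Real.arctan (Real.tanh w)) ∧ Continuous (fun w : ℝ ↦ Real.arctan ((2 + Real.sqrt 3) * Real.tanh w) + Real.arctan (Real.tanh w)) ∧ (∀ w : ℝ, |Real.arctan ((2 + Real.sqrt 3) * Real.tanh w) + Real.arctan (Real.tanh w)| < 2 * Real.pi / 3) ∧ Filter.Tendsto (fun w : ℝ ↦ Real.arctan ((2 + Real.sqrt 3) * Real.tanh w) + Real.arctan (Real.tanh w)) Filter.atTop (nhds (2 * Real.pi / 3)) ∧ (∀ y : ℝ, 0 ≤ y → y < 2 * Real.pi / 3 → ∃ w : ℝ, 0 ≤ w ∧ Real.arctan ((2 + Real.sqrt 3) * Real.tanh w) + Real.arctan (Real.tanh w) = y) ∧ StrictMono (fun x : ℝ ↦ Real.arctan (Real.tanh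 x / Real.sqrt 3)) ∧ Continuous (fun x : ℝ ↦ Real.arctan (Real.tanh x / Real.sqrt 3)) ∧ (∀ x : ℝ, |Real.arctan (Real.tanh x / Real.sqrt 3)| < Real.pi / 6) ∧ Filter.Tendsto (fun x : ℝ ↦ Real.arctan (Real.tanh x / Real.sqrt 3)) Filter.atTop (nhds (Real.pi / 6)) ∧ (∀ w : ℝ, 0 < 4 * Real.sinh w ^ 2 + 2 - Real.sqrt 3 ∧ 1 < (4 * Real.sinh w ^ 2 + 2) / (4 * Real.sinh w ^ 2 + 2 - Real.sqrt 3) ∧ (4 * Real.sinh w ^ 2 + 2) / (4 * Real.sinh w ^ 2 + 2 - Real.sqrt 3) ≤ 4 + 2 * Real.sqrt 3) ∧ Continuous (fun w : ℝ ↦ (4 * Real.sinh w ^ 2 + 2) / (4 * Real.sinh w ^ 2 + 2 - Real.sqrt 3)) ∧ AntitoneOn (fun w : ℝ ↦ (4 * Real.sinh w ^ 2 + 2) / (4 * Real.sinh w ^ 2 + 2 - Real.sqrt 3)) (Set.Ici 0) ∧ Filter.Tendsto (fun w : ℝ ↦ (4 * Real.sinh w ^ 2 + 2) / (4 * Real.sinh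 w ^ 2 + 2 - Real.sqrt 3)) Filter.atTop (nhds 1) ∧ (∀ (M n : ℕ) (w : Fin M → ℝ), 0 < (∏ j, (4 * Real.sinh (w j) ^ 2 + 2) / (4 * Real.sinh (w j) ^ 2 + 2 - Real.sqrt 3)) / 2 ^ (2 * n + 1) ∧ -Real.log ((∏ j, (4 * Real.sinh (w j) ^ 2 + 2) / (4 * Real.sinh (w j) ^ 2 + 2 - Real.sqrt 3)) / 2 ^ (2 * n + 1)) = (2 * n + 1 : ℕ) * Real.log 2 - ∑ j, Real.log ((4 * Real.sinh (w j) ^ 2 + 2) / (4 * Real.sinh (w j) ^ 2 + 2 - Real.sqrt 3))) :=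
  ⟨bk_F_strictMono, bk_F_continuous, bk_F_abs_lt, bk_F_tendsto_atTop, fun _ hy0 hy => bk_F_surjOn hy0 hy,
    bk_G_strictMono, bk_G_continuous, bk_G_abs_lt, bk_G_tendsto_atTop,
    fun w => ⟨bk_f_den_pos w, bk_one_lt_f w, bk_f_le w⟩, bk_f_continuous, bk_f_antitoneOn, bk_f_tendsto_atTop,
    fun _ n w => ⟨bk_betheLambda_pos n w, bk_neg_log_betheLambda n w⟩⟩

end Summit.CriticalPhenomena.CardyFormulaZ2.Cruxes.StripClusterRates.TwoClusterRateIsStationaryGap
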